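import Mathlib.RingTheory.GradedAlgebra.HomogeneousLocalization
import HarnessLib

/-!
# The degree-zero retraction of `A_f` onto `A_{(f)}` (crux `FInjectiveMacaulayfication`, line `Sketch`)

Support file for crux stmt-ResolutionOfSingularities-15315 (`FrobeniusLadder.FInjectiveMacaulayfication`,
line `Sketch`), stub `stub_awayDegreeZeroRetract` of the cycle-4 DEGREE-ZERO DESCENT package. The descent
engine (`…Theorems.FInjectiveMacaulayfication.DegreeZeroDescent.inlineClause_localization_of_retract`)
descends the Cohen–Macaulay + F-injective clause from a ring `B` to a subring `A₀ ⊆ B` along an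
`A₀`-LINEAR RETRACTION `ρ : B →ₗ[A₀] A₀` of the inclusion. Its geometric instance is a chart of a
(weighted) blow-up `Proj A`: for an `ℕ`-graded algebra `A = ⊕ₙ 𝒜 n` and a homogeneous `f ∈ 𝒜 i`, the
chart ring is the degree-zero part `A_{(f)} = HomogeneousLocalization.Away 𝒜 f` of the localization
`A_f = Localization.Away f`, and this file supplies the retraction

* `stub_awayDegreeZeroRetract` — there is an `A_{(f)}`-linear map `ρ : A_f → A_{(f)}` with
  `ρ ∘ (A_{(f)} ↪ A_f) = id`, namely the "degree-zero part of a fraction"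
  `x / fⁿ ↦ x_{n·i} / fⁿ` (`x_{n·i}` the homogeneous component of `x` of degree `n • i`).

Proof layout (all glue on Mathlib's `HomogeneousLocalization` / `Localization` / `DirectSum.decompose`
API; no definitions, no named facts). Write `v a n := x_{n i}/fⁿ = Away.mk 𝒜 hf n (decompose 𝒜 a (n • i))`.
* `awayMk_decompose_eq_of_mul_eq` — well-definedness: if `fᶜ (fᵐ a) = fᶜ (fⁿ b)` in `A` then
  `v a n = v b m` (take homogeneous components of degree `(c + m + n) i`,
  `DirectSum.coe_decompose_mul_add_of_left_mem`);
* `awayMk_decompose_eq_of_pow_eq` — independence of the exponent: `fⁿ = fⁿ'` forces `v a n = v a n'`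
  (either `fⁿ = 0` and `A_{(f)}` is trivial, or `n i = n' i` by `DirectSum.degree_eq_of_mem_mem`);
* `exists_degreeZeroPart` — hence `Localization.liftOn` defines `ρ₀ : A_f → A_{(f)}` with
  `ρ₀ (a / s) = v a n` whenever `s = fⁿ`;
* `awayMk_decompose_add` / `awayMk_decompose_mul` / `awayMk_decompose_self` — the computations making
  `ρ₀` additive, `A_{(f)}`-linear (`(x/fᵏ) · (a/fⁿ) ↦ x a_{n i}/fᵏ⁺ⁿ` for `x ∈ 𝒜 (k i)`) and a
  retraction (`x_{k i} = x` for `x ∈ 𝒜 (k i)`, `DirectSum.decompose_of_mem_same`);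
* `stub_awayDegreeZeroRetract` packages `ρ₀` as a linear map (every element of `A_f` is `a / fⁿ`,
  every element of `A_{(f)}` is `x / fᵏ` with `x ∈ 𝒜 (k i)`, `HomogeneousLocalization.Away.mk_surjective`).

## References

* [EGA II] A. Grothendieck, *Éléments de géométrie algébrique II*, Publ. Math. IHÉS 8 (1961), §2.2
  (the ring `A_{(f)}` and `A_f = ⊕ₙ (A_f)ₙ` with `(A_f)₀ = A_{(f)}`); folklore.
* [Har77] R. Hartshorne, *Algebraic Geometry*, GTM 52 (1977), Prop. II.2.5 (charts of `Proj`).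
-/

-- single-problem summit: the doubled namespace component is forced
set_option linter.dupNamespace false

namespace Summit.ResolutionOfSingularities.ResolutionOfSingularities.Theorems.FInjectiveMacaulayfication.AwayDegreeZero

open DirectSum HomogeneousLocalization

variable {R A : Type*} [CommRing R] [CommRing A] [Algebra R A] (𝒜 : ℕ → Submodule R A)
  [GradedAlgebra 𝒜] {i : ℕ} {f : A}

/-- Well-definedness of the degree-zero part of a fraction: if `fᶜ · (fᵐ · a) = fᶜ · (fⁿ · b)` in `A`
(i.e. `a / fⁿ = b / fᵐ` in `A_f`, `Localization.r_iff_exists`), then `a_{n i} / fⁿ = b_{m i} / fᵐ` in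
`A_{(f)}`: compare the homogeneous components of degree `c i + (m i + n i)` of both sides
(`DirectSum.coe_decompose_mul_add_of_left_mem` with the homogeneous `fᶜ, fᵐ, fⁿ`). [folklore] -/
theorem awayMk_decompose_eq_of_mul_eq (hf : f ∈ 𝒜 i) {a b : A} {n m c : ℕ}
    (h : f ^ c * (f ^ m * a) = f ^ c * (f ^ n * b)) :
    Away.mk 𝒜 hf n (decompose 𝒜 a (n • i)) (SetLike.coe_mem _) =
      Away.mk 𝒜 hf m (decompose 𝒜 b (m • i)) (SetLike.coe_mem _) := by
  have h2 : (decompose 𝒜 (f ^ c * (f ^ m * a)) (c • i + (m • i + n • i)) : A) =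
      decompose 𝒜 (f ^ c * (f ^ n * b)) (c • i + (m • i + n • i)) := by
    rw [h]
  rw [coe_decompose_mul_add_of_left_mem 𝒜 (SetLike.pow_mem_graded c hf),
    coe_decompose_mul_add_of_left_mem 𝒜 (SetLike.pow_mem_graded m hf), add_comm (m • i) (n • i),
    coe_decompose_mul_add_of_left_mem 𝒜 (SetLike.pow_mem_graded c hf),
    coe_decompose_mul_add_of_left_mem 𝒜 (SetLike.pow_mem_graded n hf)] at h2
  refine val_injective _ ?_
  rw [Away.val_mk, Away.val_mk, Localization.mk_eq_mk_iff, Localization.r_iff_exists]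
  exact ⟨⟨f ^ c, c, rfl⟩, h2⟩

/-- Independence of the exponent: if `fⁿ = fⁿ'` then `a_{n i} / fⁿ = a_{n' i} / fⁿ'` in `A_{(f)}`.
Either `fⁿ = 0`, and then `0 ∈ {fᵏ}` so `A_{(f)}` is the zero ring
(`HomogeneousLocalization.subsingleton`), or `fⁿ ≠ 0` lies in both `𝒜 (n i)` and `𝒜 (n' i)`, forcing
`n i = n' i` (`DirectSum.degree_eq_of_mem_mem`). [folklore] -/
theorem awayMk_decompose_eq_of_pow_eq (hf : f ∈ 𝒜 i) (a : A) {n n' : ℕ} (h : f ^ n = f ^ n') :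
    Away.mk 𝒜 hf n (decompose 𝒜 a (n • i)) (SetLike.coe_mem _) =
      Away.mk 𝒜 hf n' (decompose 𝒜 a (n' • i)) (SetLike.coe_mem _) := by
  by_cases hfn : f ^ n = 0
  · haveI := HomogeneousLocalization.subsingleton 𝒜 (x := Submonoid.powers f) ⟨n, hfn⟩
    exact Subsingleton.elim _ _
  have hn' : f ^ n ∈ 𝒜 (n' • i) := by
    rw [h]
    exact SetLike.pow_mem_graded n' hf
  have hdeg : n • i = n' • i :=
    DirectSum.degree_eq_of_mem_mem 𝒜 (SetLike.pow_mem_graded n hf) hn' hfn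
  refine val_injective _ ?_
  rw [Away.val_mk, Away.val_mk, Localization.mk_eq_mk_iff, Localization.r_iff_exists]
  refine ⟨1, ?_⟩
  simp only [OneMemClass.coe_one, one_mul]
  rw [h, hdeg]

/-- The degree-zero part as a function `ρ₀ : A_f → A_{(f)}`: there is a function with
`ρ₀ (a / s) = a_{n i} / fⁿ` whenever `s = fⁿ` (defined by `Localization.liftOn` with SOME exponent of the
denominator, well defined by `awayMk_decompose_eq_of_mul_eq`, independent of the exponent by
`awayMk_decompose_eq_of_pow_eq`). [folklore] -/
theorem exists_degreeZeroPart (hf : f ∈ 𝒜 i) :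
    ∃ ρ₀ : Localization.Away f → HomogeneousLocalization.Away 𝒜 f,
      ∀ (a : A) (s : Submonoid.powers f) (n : ℕ), (s : A) = f ^ n →
        ρ₀ (Localization.mk a s) = Away.mk 𝒜 hf n (decompose 𝒜 a (n • i)) (SetLike.coe_mem _) := by
  refine ⟨fun z => z.liftOn
    (fun a s => Away.mk 𝒜 hf ((Submonoid.mem_powers_iff _ _).mp s.2).choose
      (decompose 𝒜 a (((Submonoid.mem_powers_iff _ _).mp s.2).choose • i)) (SetLike.coe_mem _))
    ?_, ?_⟩
  · intro a b s t hst
    obtain ⟨u, hu⟩ := Localization.r_iff_exists.mp hst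
    obtain ⟨_, c, rfl⟩ := u
    apply awayMk_decompose_eq_of_mul_eq 𝒜 hf (c := c)
    rw [((Submonoid.mem_powers_iff _ _).mp s.2).choose_spec,
      ((Submonoid.mem_powers_iff _ _).mp t.2).choose_spec]
    simpa using hu
  · intro a s n hs
    simp only [Localization.liftOn_mk]
    exact awayMk_decompose_eq_of_pow_eq 𝒜 hf a
      (((Submonoid.mem_powers_iff _ _).mp s.2).choose_spec.trans hs)

/-- Additivity of the degree-zero part on fractions:
`(fⁿ b + fᵐ a)_{(n+m) i} / fⁿ⁺ᵐ = a_{n i} / fⁿ + b_{m i} / fᵐ` in `A_{(f)}` (the numerator on the left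
is that of `a / fⁿ + b / fᵐ`, `Localization.add_mk`; its component of degree `n i + m i` is
`fⁿ b_{m i} + fᵐ a_{n i}`). [folklore] -/
theorem awayMk_decompose_add (hf : f ∈ 𝒜 i) (a b : A) (n m : ℕ) :
    Away.mk 𝒜 hf (n + m) (decompose 𝒜 (f ^ n * b + f ^ m * a) ((n + m) • i)) (SetLike.coe_mem _) =
      Away.mk 𝒜 hf n (decompose 𝒜 a (n • i)) (SetLike.coe_mem _) +
        Away.mk 𝒜 hf m (decompose 𝒜 b (m • i)) (SetLike.coe_mem _) := by
  refine val_injective _ ?_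
  rw [val_add, Away.val_mk, Away.val_mk, Away.val_mk, Localization.add_mk,
    Localization.mk_eq_mk_iff, Localization.r_iff_exists]
  refine ⟨1, ?_⟩
  simp only [OneMemClass.coe_one, one_mul, Submonoid.coe_mul, decompose_add, add_apply,
    Submodule.coe_add]
  rw [add_nsmul, coe_decompose_mul_add_of_left_mem 𝒜 (SetLike.pow_mem_graded n hf),
    add_comm (n • i) (m • i), coe_decompose_mul_add_of_left_mem 𝒜 (SetLike.pow_mem_graded m hf)]
  ring

/-- Linearity of the degree-zero part over `A_{(f)}` on fractions: for `x ∈ 𝒜 (k i)`,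
`(x a)_{(k+n) i} / fᵏ⁺ⁿ = (x / fᵏ) · (a_{n i} / fⁿ)` in `A_{(f)}`
(`(x a)_{k i + n i} = x a_{n i}`, `DirectSum.coe_decompose_mul_add_of_left_mem`). [folklore] -/
theorem awayMk_decompose_mul (hf : f ∈ 𝒜 i) {k : ℕ} {x : A} (hx : x ∈ 𝒜 (k • i)) (a : A) (n : ℕ) :
    Away.mk 𝒜 hf (k + n) (decompose 𝒜 (x * a) ((k + n) • i)) (SetLike.coe_mem _) =
      Away.mk 𝒜 hf k x hx * Away.mk 𝒜 hf n (decompose 𝒜 a (n • i)) (SetLike.coe_mem _) := by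
  refine val_injective _ ?_
  rw [val_mul, Away.val_mk, Away.val_mk, Away.val_mk, Localization.mk_mul,
    Localization.mk_eq_mk_iff, Localization.r_iff_exists]
  refine ⟨1, ?_⟩
  simp only [OneMemClass.coe_one, one_mul, Submonoid.coe_mul]
  rw [add_nsmul, coe_decompose_mul_add_of_left_mem 𝒜 hx]
  ring

/-- The degree-zero part fixes degree-zero fractions: for `x ∈ 𝒜 (k i)`, `x_{k i} / fᵏ = x / fᵏ`
(`DirectSum.decompose_of_mem_same`). [folklore] -/
theorem awayMk_decompose_self (hf : f ∈ 𝒜 i) {k : ℕ} {x : A} (hx : x ∈ 𝒜 (k • i)) :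
    Away.mk 𝒜 hf k (decompose 𝒜 x (k • i)) (SetLike.coe_mem _) = Away.mk 𝒜 hf k x hx := by
  refine val_injective _ ?_
  rw [Away.val_mk, Away.val_mk, decompose_of_mem_same 𝒜 hx]

/-- **The degree-zero retraction of a blow-up chart** (Sketch `stub_awayDegreeZeroRetract`). For an
`ℕ`-graded algebra `A = ⊕ₙ 𝒜 n` and a homogeneous element `f ∈ 𝒜 i`, the degree-zero subring
`A_{(f)} = HomogeneousLocalization.Away 𝒜 f` of `A_f = Localization.Away f` is a direct summand of `A_f`
as an `A_{(f)}`-module: the degree-zero part of a fraction `a / fⁿ ↦ a_{n i} / fⁿ` is a well-defined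
(`exists_degreeZeroPart`), additive (`awayMk_decompose_add`), `A_{(f)}`-linear (`awayMk_decompose_mul`)
map `ρ : A_f →ₗ[A_{(f)}] A_{(f)}` with `ρ (x / fᵏ) = x / fᵏ` for `x ∈ 𝒜 (k i)`
(`awayMk_decompose_self`), i.e. `ρ ∘ algebraMap A_{(f)} A_f = id`. This is the retraction fed to the
degree-zero descent engine on a chart of a (weighted) blow-up. [folklore] -/
theorem stub_awayDegreeZeroRetract : ∀ (R A : Type) [CommRing R] [CommRing A] [Algebra R A]
    (𝒜 : ℕ → Submodule R A) [GradedAlgebra 𝒜] (i : ℕ) (f : A), f ∈ 𝒜 i →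
    ∃ ρ : Localization.Away f →ₗ[HomogeneousLocalization.Away 𝒜 f] HomogeneousLocalization.Away 𝒜 f,
      ∀ a : HomogeneousLocalization.Away 𝒜 f,
        ρ (algebraMap (HomogeneousLocalization.Away 𝒜 f) (Localization.Away f) a) = a := by
  intro R A _ _ _ 𝒜 _ i f hf
  obtain ⟨ρ₀, hρ₀⟩ := exists_degreeZeroPart 𝒜 hf
  have hsurj : ∀ z : Localization.Away f,
      ∃ (a : A) (n : ℕ) (hn : f ^ n ∈ Submonoid.powers f), z = Localization.mk a ⟨f ^ n, hn⟩ := by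
    intro z
    induction z using Localization.induction_on with
    | H y =>
      rcases y with ⟨a, s, hs⟩
      obtain ⟨n, rfl⟩ := (Submonoid.mem_powers_iff _ _).mp hs
      exact ⟨a, n, hs, rfl⟩
  refine ⟨{ toFun := ρ₀, map_add' := ?_, map_smul' := ?_ }, ?_⟩
  · intro z w
    obtain ⟨a, n, hn, rfl⟩ := hsurj z
    obtain ⟨b, m, hm, rfl⟩ := hsurj w
    have e : ((⟨f ^ n, hn⟩ * ⟨f ^ m, hm⟩ : Submonoid.powers f) : A) = f ^ (n + m) := by
      rw [Submonoid.coe_mul, pow_add]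
    rw [Localization.add_mk, hρ₀ _ _ _ e, hρ₀ a ⟨f ^ n, hn⟩ n rfl, hρ₀ b ⟨f ^ m, hm⟩ m rfl]
    exact awayMk_decompose_add 𝒜 hf a b n m
  · intro c z
    obtain ⟨a, n, hn, rfl⟩ := hsurj z
    obtain ⟨k, x, hx, rfl⟩ := Away.mk_surjective 𝒜 hf c
    have e : ((⟨f ^ k, k, rfl⟩ * ⟨f ^ n, hn⟩ : Submonoid.powers f) : A) = f ^ (k + n) := by
      rw [Submonoid.coe_mul, pow_add]
    rw [RingHom.id_apply, smul_eq_mul, Algebra.smul_def, HomogeneousLocalization.algebraMap_apply,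
      Away.val_mk, Localization.mk_mul, hρ₀ _ _ _ e, hρ₀ a ⟨f ^ n, hn⟩ n rfl]
    exact awayMk_decompose_mul 𝒜 hf hx a n
  · intro c
    obtain ⟨k, x, hx, rfl⟩ := Away.mk_surjective 𝒜 hf c
    rw [LinearMap.coe_mk, AddHom.coe_mk, HomogeneousLocalization.algebraMap_apply, Away.val_mk,
      hρ₀ x ⟨f ^ k, k, rfl⟩ k rfl]
    exact awayMk_decompose_self 𝒜 hf hx

end Summit.ResolutionOfSingularities.ResolutionOfSingularities.Theorems.FInjectiveMacaulayfication.AwayDegreeZero
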